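import Summits.QuantumFields.YangMills.Theorems.ConvexGribovBodyContinuumLegGivenGapCsclObs
import Summits.QuantumFields.YangMills.Theorems.ConvexGribovBodyContinuumLegGivenGapStubPairToNorm
import Summits.QuantumFields.YangMills.Theorems.ConvexGribovBodyContinuumLegGivenGapStubBilinearUBP
import HarnessLib

/-!
# `ContinuumLegGivenGap` (stmt-QuantumFields-15828), line `Sketch`, reshape 17-CS, helper 6 of `stub_csclOfLock`:
# box-uniform clustering constants from the lock (Banach–Steinhaus) and the self-correlation bound of a complex
# observable with real local parts

At one coupling `β'` with rate `M` and threshold `S₁'` (one index of the crux's locked datum), the per-pair clustering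
`|corr_{β'}(2S+1; A, B; n)| ≤ C(A,B) e^{−Mn}` (`S ≥ S₁'`, `n ≤ S`) is upgraded, for every fixed pair of supports, to the
product form `≤ K ‖A‖∞ ‖B‖∞ e^{−Mn}` with ONE `K = K(Λ₁, Λ₂) ≥ 0` (`cscl_bs`: the landed `stub_pairToNorm stub_bilinearUBP`).
Consequently a complex observable `Z = Z₁ + iZ₂` whose parts are local gauge-invariant observables with support `Λ`,
reflections supported on `Λθ` and sup bounds `≤ B`, has reflected connected self-correlation
`≤ 4 K(Λθ,Λ) B² e^{−Mn}` for all `n ≤ S`, `S ≥ S₁'` (`cscl_selfCorr_bound`) — the `D_X` of `cscl_torus_pair`.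
Registered anchor: `cscl_anchor_constants`. No definitions. [folklore]
-/

noncomputable section

open scoped ComplexConjugate
open MeasureTheory Filter
open Literature.MathematicalPhysics.QuantumFieldTheory Literature.MathematicalPhysics.QuantumLattice
open Summit.QuantumFields.YangMills.Theorems.ClusteringToYangMills.Reconstructible

namespace Summit.QuantumFields.YangMills.Theorems.ContinuumLegGivenGap

section BS

variable {G : Type} [Group G] [TopologicalSpace G] [IsTopologicalGroup G] [CompactSpace G]
  [MeasurableSpace G] [BorelSpace G] (r : LatticeRep G)

/-- **Box-uniform constants (Banach–Steinhaus).** [folklore] -/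
theorem cscl_bs {β' M : ℝ} {S₁' : ℕ}
    (hlock : ∀ A B : YMSpecies G, ∃ C : ℝ, ∀ S n : ℕ, S₁' ≤ S → n ≤ S →
      |latticeConnectedCorr r.ρ β' (2 * S + 1) A.F B.F n| ≤ C * Real.exp (-(M * n)))
    (Λ₁ Λ₂ : Finset (Literature.MathematicalPhysics.QuantumLattice.ZdEdge 4)) :
    ∃ K : ℝ, 0 ≤ K ∧ ∀ A B : YMSpecies G, A.supp = Λ₁ → B.supp = Λ₂ → ∀ S n : ℕ, S₁' ≤ S → n ≤ S →
      |latticeConnectedCorr r.ρ β' (2 * S + 1) A.F B.F n| ≤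
        K * (⨆ U, |A.F U|) * (⨆ U, |B.F U|) * Real.exp (-(M * n)) := by
  obtain ⟨K, hK⟩ := stub_pairToNorm stub_bilinearUBP G r Λ₁ Λ₂
    (fun β S n => β = β' ∧ S₁' ≤ S ∧ n ≤ S) (fun _ _ n => Real.exp (-(M * n))) (fun _ _ _ _ => Real.exp_pos _)
    (fun A B hA hB => by
      obtain ⟨C, hC⟩ := hlock A B
      exact ⟨C, fun β S n hP => by obtain ⟨rfl, h1, h2⟩ := hP; exact hC S n h1 h2⟩)
  refine ⟨max K 0, le_max_right _ _, fun A B hA hB S n h1 h2 => ?_⟩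
  refine (hK A B hA hB β' S n ⟨rfl, h1, h2⟩).trans ?_
  have hA0 : 0 ≤ ⨆ U, |A.F U| := Real.iSup_nonneg fun U => abs_nonneg _
  have hB0 : 0 ≤ ⨆ U, |B.F U| := Real.iSup_nonneg fun U => abs_nonneg _
  gcongr
  exact le_max_left _ _

omit [TopologicalSpace G] [IsTopologicalGroup G] [CompactSpace G] [BorelSpace G] in
/-- The sup of `|A.F|` is at most any uniform bound. [folklore] -/
theorem cscl_iSup_le {A : YMSpecies G} {B : ℝ} (hB : ∀ U, |A.F U| ≤ B) : (⨆ U, |A.F U|) ≤ B :=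
  ciSup_le hB

/-- **The self-correlation bound of a complex observable with real local parts** (the `D_X` of `cscl_torus_pair`):
with `K = K(Λθ, Λ)` from `cscl_bs`, parts `O₁, O₂` supported on `Λ`, reflections `O₁', O₂'` (`Oⱼ'.F = Oⱼ.F ∘ Θ`)
supported on `Λθ`, and `|Oⱼ.F| ≤ B`: the reflected connected self-correlation of `Z = O₁.F + i O₂.F` is
`≤ 4 K B² e^{−Mn}` for `S ≥ S₁'`, `n ≤ S`. [folklore] -/
theorem cscl_selfCorr_bound {β' M K B : ℝ} {S₁' : ℕ}
    {Λ Λθ : Finset (Literature.MathematicalPhysics.QuantumLattice.ZdEdge 4)} (hK0 : 0 ≤ K)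
    (hK : ∀ A B' : YMSpecies G, A.supp = Λθ → B'.supp = Λ → ∀ S n : ℕ, S₁' ≤ S → n ≤ S →
      |latticeConnectedCorr r.ρ β' (2 * S + 1) A.F B'.F n| ≤
        K * (⨆ U, |A.F U|) * (⨆ U, |B'.F U|) * Real.exp (-(M * n)))
    (O₁ O₂ O₁' O₂' : YMSpecies G) (h1 : O₁.supp = Λ) (h2 : O₂.supp = Λ) (h1' : O₁'.supp = Λθ) (h2' : O₂'.supp = Λθ)
    (hF1 : O₁'.F = O₁.F ∘ gaugeTimeReflect) (hF2 : O₂'.F = O₂.F ∘ gaugeTimeReflect)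
    (hB0 : 0 ≤ B) (hB1 : ∀ U, |O₁.F U| ≤ B) (hB2 : ∀ U, |O₂.F U| ≤ B) {S : ℕ} (hS : S₁' ≤ S) {n : ℕ} (hn : n ≤ S) :
    ‖(∫ U, conj ((O₁.F (gaugeTimeReflect (torusLift (2 * S + 1) U)) : ℂ) +
            Complex.I * (O₂.F (gaugeTimeReflect (torusLift (2 * S + 1) U)) : ℂ)) *
          ((O₁.F (configShift (-(Pi.single 0 (n : ℤ))) (torusLift (2 * S + 1) U)) : ℂ) +
            Complex.I * (O₂.F (configShift (-(Pi.single 0 (n : ℤ))) (torusLift (2 * S + 1) U)) : ℂ))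
          ∂(wilsonMeasure (d := 4) (L := 2 * S + 1) r.ρ β')) -
        conj (∫ V, ((O₁.F (torusLift (2 * S + 1) V) : ℂ) + Complex.I * (O₂.F (torusLift (2 * S + 1) V) : ℂ))
            ∂(wilsonMeasure (d := 4) (L := 2 * S + 1) r.ρ β')) *
          (∫ V, ((O₁.F (torusLift (2 * S + 1) V) : ℂ) + Complex.I * (O₂.F (torusLift (2 * S + 1) V) : ℂ))
            ∂(wilsonMeasure (d := 4) (L := 2 * S + 1) r.ρ β'))‖ ≤
      4 * K * B ^ 2 * Real.exp (-(M * n)) := by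
  have hle := cscl_selfCorr_le r.ρ r.continuous β' S O₁.measurable O₂.measurable O₁.bounded O₂.bounded n
  refine hle.trans ?_
  -- each of the four real correlations is `≤ K B² e^{-Mn}`
  have hB1' : ∀ U, |O₁'.F U| ≤ B := fun U => by rw [hF1]; exact hB1 _
  have hB2' : ∀ U, |O₂'.F U| ≤ B := fun U => by rw [hF2]; exact hB2 _
  have hone : ∀ (A B' : YMSpecies G), A.supp = Λθ → B'.supp = Λ → (∀ U, |A.F U| ≤ B) → (∀ U, |B'.F U| ≤ B) →
      |latticeConnectedCorr r.ρ β' (2 * S + 1) A.F B'.F n| ≤ K * B ^ 2 * Real.exp (-(M * n)) := by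
    intro A B' hA hB' hAB hBB
    refine (hK A B' hA hB' S n hS hn).trans ?_
    have hA0 : 0 ≤ ⨆ U, |A.F U| := Real.iSup_nonneg fun U => abs_nonneg _
    have hBs0 : 0 ≤ ⨆ U, |B'.F U| := Real.iSup_nonneg fun U => abs_nonneg _
    have e0 : 0 ≤ Real.exp (-(M * n)) := (Real.exp_pos _).le
    calc K * (⨆ U, |A.F U|) * (⨆ U, |B'.F U|) * Real.exp (-(M * n))
        ≤ K * B * B * Real.exp (-(M * n)) := by
          gcongr
          · exact cscl_iSup_le hAB
          · exact cscl_iSup_le hBB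
      _ = K * B ^ 2 * Real.exp (-(M * n)) := by ring
  have c11 := hone O₁' O₁ h1' h1 hB1' hB1
  have c22 := hone O₂' O₂ h2' h2 hB2' hB2
  have c12 := hone O₁' O₂ h1' h2 hB1' hB2
  have c21 := hone O₂' O₁ h2' h1 hB2' hB1
  rw [hF1] at c11 c12
  rw [hF2] at c22 c21
  linarith

end BS

/-- **Registered anchor of this file** (closed form of `cscl_iSup_le`, for the gate's `--supports` stub check).
[folklore] -/
theorem cscl_anchor_constants :
    ∀ (G : Type) [Group G] [MeasurableSpace G] (A : YMSpecies G) (B : ℝ), (∀ U, |A.F U| ≤ B) → (⨆ U, |A.F U|) ≤ B :=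
  fun _ _ _ _ _ hB => ciSup_le hB

end Summit.QuantumFields.YangMills.Theorems.ContinuumLegGivenGap

end
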